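import Summits.HubbardSuperconductivity.HubbardSuperconductivity.Theorems.KacWindowPenaltyWindowGapFloorSplit
import Literature.MathematicalPhysics.QuantumLattice.GriffithsLemmaGroundStates

/-!
# Route `KacWindowPenalty` — crux `WindowGap` (stmt-HubbardSuperconductivity-1088):
# summit strength of the crux, and the two-sided (no-kink) split

Strategist r1 (redirect second opinion, 2026-08-17) companion of
`…Theorems.KacWindowPenaltyWindowGapSummitSplit` (ORDER ∧ ROBUSTNESS, p137387) and
`…Theorems.KacWindowPenaltyWindowGapFloorSplit` (FLOOR ∧ ROBUSTNESS, p149936). Notation (all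
spelled out in the signatures): `H_L = hubbardTorus 2 L 1 U`, `K_L = szSector N_L 0`,
`N_L = 2⌊(1−δ)L²/2⌋`, `Δ_d(m) = pairFieldAt dWaveFormFactor L m`, the crux's Kac window
`W_ε = Σ_m [ |q_m| ≤ ε ] L⁻² • Δ_d(m)ᴴ Δ_d(m)`, `g_L(λ) = minEnergyOn (H_L + λ W_ε) K_L`; FLOOR at
`(U, δ)` = every normalised sector ground state has `(Cε + a)L² ≤ Re ⟨ψ, W_ε ψ⟩` (`∀ C ∀ ε₀ ∃ ε ≤ ε₀
∃ a > 0 ∃ L₀`), GAP at `(U, δ)` = the crux body, SUMMIT MATRIX at `(U, δ)` = the summit's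
conclusion at the point. This module records, definition-free and with no physics:

* `exists_windowFloorAt_of_hubbardSuperconductivity` — the SUMMIT implies the floor at its own
  witness point (every-GS order ⇒ floor, `windowFloorAt_of_everyGSOrderAt`), with no tail bound;
* `hubbardSuperconductivity_iff_exists_windowFloorAt_of_wib` — GIVEN the sibling crux
  `WindowInfraredBound`, "floor at some `U > 0`, `δ ∈ (0,1/2)`" is EQUIVALENT to the summit; since
  `WindowGap` implies that floor (`exists_windowFloorAt_of_windowGap`), the part of the crux the
  route consumes is the summit itself, neither more nor less;
* `windowGap_iff_exists_summitMatrix_and_stiff_of_wib` — GIVEN `WindowInfraredBound`,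
  `WindowGap ↔ ∃ (U, δ), (summit matrix at (U, δ)) ∧ (FLOOR → GAP at (U, δ))`: the crux is
  literally "the summit at a point, plus window stiffness at that point" — summit strength;
* the r1 split (census v3 §Decomposition D10): NO-KINK at `(U, δ)` — for every `ε > 0`, `η > 0`
  some `λ > 0` makes, eventually in even `L`, the second difference of `g_L` at zero coupling
  `≥ −η λ L²`: `(g_L(0) − g_L(−λ)) − (g_L(λ) − g_L(0)) ≤ η λ L²` (the ATTRACTIVE Kac window
  `λ < 0` and the repulsive one respond alike to first order, uniformly in `L`);
  `windowGapAt_of_windowFloorAt_of_noKinkAt`: FLOOR → NO-KINK → GAP (left secant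
  `g_L(0) − g_L(−λ) ≥ λ Re ⟨ψ₀, W_ε ψ₀⟩` by the variational principle at a ground state `ψ₀`,
  then the no-kink bound transfers it to the right secant, `a` halved); hence
  `windowGap_of_hubbardSuperconductivity_of_noKink`: the summit plus no-kink at its point gives the
  crux — modulo {`WindowInfraredBound`, no-kink} the crux and the summit coincide.

Reading (census v3 §0): `WindowGap` and its floor differ exactly by the interchange of
`λ → 0⁺` with `L → ∞` in `(g_L(λ) − g_L(0))/(λL²)`; no-kink is that interchange. Supports for the
crux (`--supports stmt-HubbardSuperconductivity-1088`); nothing here is a line of attack.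
H. Tasaki, *Physics and Mathematics of Quantum Many-Body Systems* (2020) §2.1 (variational
principle); R. B. Griffiths, J. Math. Phys. 5 (1964) 1215 (convexity in a coupling);
D. J. Scalapino, Phys. Rep. 250 (1995) 329, §2. No new definitions.
-/

-- the mandated namespace `Summit.<Summit>.<Problem>.Theorems` repeats `HubbardSuperconductivity`
-- (single-problem summit, D-0017), which the `dupNamespace` linter flags on every declaration
set_option linter.dupNamespace false

namespace Summit.HubbardSuperconductivity.HubbardSuperconductivity.Theorems

open Matrix Literature.MathematicalPhysics.QuantumLattice Literature.Probability.LatticeModels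
open Summit.HubbardSuperconductivity.HubbardSuperconductivity.Theses.KacWindowPenalty
  (WindowGap WindowInfraredBound)
open Summit.HubbardSuperconductivity.TwTipContinuation.Negative
  (summitMatrix_of_everyGSOrder summitMatrix_iff_everyGSOrder)

/-! ### The summit implies the floor; given the tail bound the floor is the summit -/

/-- **The summit implies the window floor at its witness point.** From `HubbardSuperconductivity`
take `U > 0`, `δ ∈ (0, 1/2)`; the summit's matrix there is every-GS `d`-wave order
(`summitMatrix_iff_everyGSOrder`), which serves every `(C, ε₀)` of the floor
(`windowFloorAt_of_everyGSOrderAt`: `ε := min ε₀ (c/(2C+1))`, `a := c/2`). No tail bound is used: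
the floor — the part of crux `WindowGap` the route consumes — is a CONSEQUENCE of the summit.
Scalapino (1995) §2; Tasaki (2020) §2.1. [folklore] -/
theorem exists_windowFloorAt_of_hubbardSuperconductivity (h : _root_.HubbardSuperconductivity) :
    ∃ U : ℝ, 0 < U ∧ ∃ δ ∈ Set.Ioo (0 : ℝ) (1 / 2),
      ∀ C : ℝ, 0 ≤ C → ∀ ε₀ : ℝ, 0 < ε₀ → ∃ ε ∈ Set.Ioc (0 : ℝ) ε₀, ∃ a : ℝ, 0 < a ∧
        ∃ L₀ : ℕ, ∀ (L : ℕ) [NeZero L], L₀ ≤ L → Even L →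
          ∀ ψ : Fock (Orb (FermionTorus 2 L)), star ψ ⬝ᵥ ψ = 1 →
            IsGroundStateInSector (hubbardTorus 2 L 1 U) (2 * ⌊(1 - δ) * (L : ℝ) ^ 2 / 2⌋₊) 0 ψ →
              (C * ε + a) * (L : ℝ) ^ 2 ≤ (star ψ ⬝ᵥ (∑ m : Fin 2 → ZMod L,
                if (2 * Real.pi / (L : ℝ)) ^ 2 * (∑ i : Fin 2, (((m i).valMinAbs : ℤ) : ℝ) ^ 2) ≤ ε ^ 2
                then ((L : ℂ) ^ 2)⁻¹ • (Matrix.conjTranspose (pairFieldAt dWaveFormFactor L m) *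
                  pairFieldAt dWaveFormFactor L m)
                else 0) *ᵥ ψ).re := by
  obtain ⟨U, hU, δ, hδ, hS⟩ := h
  exact ⟨U, hU, δ, hδ, windowFloorAt_of_everyGSOrderAt
    ((summitMatrix_iff_everyGSOrder (by linarith [hδ.1])).1 hS)⟩

/-- **Given the sibling crux, "floor at some point" IS the summit.** Under
`WindowInfraredBound` (rank 3 of the route), `HubbardSuperconductivity ↔ ∃ U > 0, δ ∈ (0,1/2),
FLOOR at (U, δ)`: `→` is `exists_windowFloorAt_of_hubbardSuperconductivity` (tail bound unused),
`←` is `hubbardSuperconductivity_of_exists_windowFloorAt_of_wib`. Since `WindowGap` implies the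
right-hand side (`exists_windowFloorAt_of_windowGap`), the route's deciding theorem factors through
a statement equivalent to its own conclusion: the consumed content of the crux is the summit.
Scalapino (1995) §2; Tasaki (2020) §2.1. [folklore] -/
theorem hubbardSuperconductivity_iff_exists_windowFloorAt_of_wib (hI : WindowInfraredBound) :
    _root_.HubbardSuperconductivity ↔
    ∃ U : ℝ, 0 < U ∧ ∃ δ ∈ Set.Ioo (0 : ℝ) (1 / 2),
      ∀ C : ℝ, 0 ≤ C → ∀ ε₀ : ℝ, 0 < ε₀ → ∃ ε ∈ Set.Ioc (0 : ℝ) ε₀, ∃ a : ℝ, 0 < a ∧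
        ∃ L₀ : ℕ, ∀ (L : ℕ) [NeZero L], L₀ ≤ L → Even L →
          ∀ ψ : Fock (Orb (FermionTorus 2 L)), star ψ ⬝ᵥ ψ = 1 →
            IsGroundStateInSector (hubbardTorus 2 L 1 U) (2 * ⌊(1 - δ) * (L : ℝ) ^ 2 / 2⌋₊) 0 ψ →
              (C * ε + a) * (L : ℝ) ^ 2 ≤ (star ψ ⬝ᵥ (∑ m : Fin 2 → ZMod L,
                if (2 * Real.pi / (L : ℝ)) ^ 2 * (∑ i : Fin 2, (((m i).valMinAbs : ℤ) : ℝ) ^ 2) ≤ ε ^ 2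
                then ((L : ℂ) ^ 2)⁻¹ • (Matrix.conjTranspose (pairFieldAt dWaveFormFactor L m) *
                  pairFieldAt dWaveFormFactor L m)
                else 0) *ᵥ ψ).re :=
  ⟨exists_windowFloorAt_of_hubbardSuperconductivity,
    fun hF => hubbardSuperconductivity_of_exists_windowFloorAt_of_wib hF hI⟩

/-! ### The crux = the summit at a point ∧ window stiffness at that point -/

/-- **Summit strength of `WindowGap`.** Under `WindowInfraredBound`:
`WindowGap ↔ ∃ U > 0, δ ∈ (0,1/2), (the summit's matrix at (U, δ)) ∧ (FLOOR at (U, δ) → GAP at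
(U, δ))`. `→`: at the crux's witness point the gap gives the floor (`windowFloorAt_of_windowGapAt`),
floor + tail give the summit's matrix (`windowFloorAt_iff_summitMatrix_of_wibAt`), and the
implication holds because its conclusion does. `←`: the summit's matrix gives every-GS order, hence
the floor (`windowFloorAt_of_everyGSOrderAt`), and the stiffness implication returns the gap. So
the crux is the summit at a point PLUS the window stiffness there (census D7, now as one
equivalence): at least summit-strength relative to the route's other crux.
Scalapino (1995) §2; Tasaki (2020) §2.1. [folklore] -/
theorem windowGap_iff_exists_summitMatrix_and_stiff_of_wib (hI : WindowInfraredBound) :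
    WindowGap ↔
    ∃ U : ℝ, 0 < U ∧ ∃ δ ∈ Set.Ioo (0 : ℝ) (1 / 2),
      (∀ (N : ℕ → ℕ) (ψ : ∀ L, Fock (Orb (FermionTorus 2 L))),
        (∀ L, Even L → N L = 2 * ⌊(1 - δ) * (L : ℝ) ^ 2 / 2⌋₊ ∧ star (ψ L) ⬝ᵥ ψ L = 1 ∧
            IsGroundStateInSector (hubbardTorus 2 L 1 U) (N L) 0 (ψ L)) →
          HasLongRangeOrder (fun k => halfOpenBox 2 (2 * k))
            (fun k => torusPullback (pairFieldCorr dWaveFormFactor ψ) (2 * k))) ∧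
      ((∀ C : ℝ, 0 ≤ C → ∀ ε₀ : ℝ, 0 < ε₀ → ∃ ε ∈ Set.Ioc (0 : ℝ) ε₀, ∃ a : ℝ, 0 < a ∧
          ∃ L₀ : ℕ, ∀ (L : ℕ) [NeZero L], L₀ ≤ L → Even L →
            ∀ ψ : Fock (Orb (FermionTorus 2 L)), star ψ ⬝ᵥ ψ = 1 →
              IsGroundStateInSector (hubbardTorus 2 L 1 U) (2 * ⌊(1 - δ) * (L : ℝ) ^ 2 / 2⌋₊) 0 ψ →
                (C * ε + a) * (L : ℝ) ^ 2 ≤ (star ψ ⬝ᵥ (∑ m : Fin 2 → ZMod L,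
                  if (2 * Real.pi / (L : ℝ)) ^ 2 * (∑ i : Fin 2, (((m i).valMinAbs : ℤ) : ℝ) ^ 2) ≤ ε ^ 2
                  then ((L : ℂ) ^ 2)⁻¹ • (Matrix.conjTranspose (pairFieldAt dWaveFormFactor L m) *
                    pairFieldAt dWaveFormFactor L m)
                  else 0) *ᵥ ψ).re) →
        ∀ C : ℝ, 0 ≤ C → ∀ ε₀ : ℝ, 0 < ε₀ → ∃ ε ∈ Set.Ioc (0 : ℝ) ε₀, ∃ lam a : ℝ, 0 < lam ∧ 0 < a ∧
          ∃ L₀ : ℕ, ∀ (L : ℕ) [NeZero L], L₀ ≤ L → Even L →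
            lam * (C * ε + a) * (L : ℝ) ^ 2 ≤
              (hubbardTorus 2 L 1 U + (lam : ℂ) • (∑ m : Fin 2 → ZMod L,
                  if (2 * Real.pi / (L : ℝ)) ^ 2 * (∑ i : Fin 2, (((m i).valMinAbs : ℤ) : ℝ) ^ 2) ≤ ε ^ 2
                  then ((L : ℂ) ^ 2)⁻¹ • (Matrix.conjTranspose (pairFieldAt dWaveFormFactor L m) *
                    pairFieldAt dWaveFormFactor L m)
                  else 0)).minEnergyOn (szSector (2 * ⌊(1 - δ) * (L : ℝ) ^ 2 / 2⌋₊) 0) -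
                (hubbardTorus 2 L 1 U).minEnergyOn (szSector (2 * ⌊(1 - δ) * (L : ℝ) ^ 2 / 2⌋₊) 0)) := by
  constructor
  · rintro ⟨U, hU, δ, hδ, hG⟩
    have hF := windowFloorAt_of_windowGapAt hG
    exact ⟨U, hU, δ, hδ,
      (windowFloorAt_iff_summitMatrix_of_wibAt (by linarith [hδ.1]) (hI U hU δ hδ)).1 hF,
      fun _ => hG⟩
  · rintro ⟨U, hU, δ, hδ, hS, hstiff⟩
    exact ⟨U, hU, δ, hδ, hstiff (windowFloorAt_of_everyGSOrderAt
      ((summitMatrix_iff_everyGSOrder (by linarith [hδ.1])).1 hS))⟩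

/-! ### The r1 split: FLOOR ∧ NO-KINK ⇒ GAP (two-sided Kac coupling) -/

/-- **FLOOR → NO-KINK → GAP at `(U, δ)`** (`δ ∈ (0, 1/2)`, used only to know `K_L ≠ ⊥`).
NO-KINK at `(U, δ)`: for every `ε > 0` and `η > 0` some `λ > 0` makes, at every large even `L`,
`(g_L(0) − g_L(−λ)) − (g_L(λ) − g_L(0)) ≤ η λ L²`. Given the floor at `(C, ε₀)` — `(ε, a, L₁)` with
`(Cε + a)L² ≤ Re ⟨ψ₀, W_ε ψ₀⟩` for every normalised sector ground state `ψ₀` — take no-kink at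
`(ε, η := a/2)`: the variational principle for `H_L − λW_ε` at a ground state `ψ₀` of `H_L`
(`exists_unit_groundStateInSector_hubbardTorus`) gives the LEFT secant
`g_L(0) − g_L(−λ) ≥ λ Re ⟨ψ₀, W_ε ψ₀⟩ ≥ λ(Cε + a)L²`, and no-kink turns it into the right secant
`g_L(λ) − g_L(0) ≥ λ(Cε + a/2)L²` — the crux body with `a` halved. No concavity is used.
Tasaki (2020) §2.1; Griffiths (1964). [folklore] -/
theorem windowGapAt_of_windowFloorAt_of_noKinkAt {U δ : ℝ} (hδ : δ ∈ Set.Ioo (0 : ℝ) (1 / 2))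
    (hF : ∀ C : ℝ, 0 ≤ C → ∀ ε₀ : ℝ, 0 < ε₀ → ∃ ε ∈ Set.Ioc (0 : ℝ) ε₀, ∃ a : ℝ, 0 < a ∧
      ∃ L₀ : ℕ, ∀ (L : ℕ) [NeZero L], L₀ ≤ L → Even L →
        ∀ ψ : Fock (Orb (FermionTorus 2 L)), star ψ ⬝ᵥ ψ = 1 →
          IsGroundStateInSector (hubbardTorus 2 L 1 U) (2 * ⌊(1 - δ) * (L : ℝ) ^ 2 / 2⌋₊) 0 ψ →
            (C * ε + a) * (L : ℝ) ^ 2 ≤ (star ψ ⬝ᵥ (∑ m : Fin 2 → ZMod L,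
              if (2 * Real.pi / (L : ℝ)) ^ 2 * (∑ i : Fin 2, (((m i).valMinAbs : ℤ) : ℝ) ^ 2) ≤ ε ^ 2
              then ((L : ℂ) ^ 2)⁻¹ • (Matrix.conjTranspose (pairFieldAt dWaveFormFactor L m) *
                pairFieldAt dWaveFormFactor L m)
              else 0) *ᵥ ψ).re)
    (hN : ∀ ε : ℝ, 0 < ε → ∀ η : ℝ, 0 < η → ∃ lam : ℝ, 0 < lam ∧ ∃ L₀ : ℕ, ∀ (L : ℕ) [NeZero L],
      L₀ ≤ L → Even L →
        ((hubbardTorus 2 L 1 U).minEnergyOn (szSector (2 * ⌊(1 - δ) * (L : ℝ) ^ 2 / 2⌋₊) 0) -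
            (hubbardTorus 2 L 1 U + ((-lam : ℝ) : ℂ) • (∑ m : Fin 2 → ZMod L,
                if (2 * Real.pi / (L : ℝ)) ^ 2 * (∑ i : Fin 2, (((m i).valMinAbs : ℤ) : ℝ) ^ 2) ≤ ε ^ 2
                then ((L : ℂ) ^ 2)⁻¹ • (Matrix.conjTranspose (pairFieldAt dWaveFormFactor L m) *
                  pairFieldAt dWaveFormFactor L m)
                else 0)).minEnergyOn (szSector (2 * ⌊(1 - δ) * (L : ℝ) ^ 2 / 2⌋₊) 0)) -
          ((hubbardTorus 2 L 1 U + (lam : ℂ) • (∑ m : Fin 2 → ZMod L,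
                if (2 * Real.pi / (L : ℝ)) ^ 2 * (∑ i : Fin 2, (((m i).valMinAbs : ℤ) : ℝ) ^ 2) ≤ ε ^ 2
                then ((L : ℂ) ^ 2)⁻¹ • (Matrix.conjTranspose (pairFieldAt dWaveFormFactor L m) *
                  pairFieldAt dWaveFormFactor L m)
                else 0)).minEnergyOn (szSector (2 * ⌊(1 - δ) * (L : ℝ) ^ 2 / 2⌋₊) 0) -
            (hubbardTorus 2 L 1 U).minEnergyOn (szSector (2 * ⌊(1 - δ) * (L : ℝ) ^ 2 / 2⌋₊) 0)) ≤
          η * lam * (L : ℝ) ^ 2) :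
    ∀ C : ℝ, 0 ≤ C → ∀ ε₀ : ℝ, 0 < ε₀ → ∃ ε ∈ Set.Ioc (0 : ℝ) ε₀, ∃ lam a : ℝ, 0 < lam ∧ 0 < a ∧
      ∃ L₀ : ℕ, ∀ (L : ℕ) [NeZero L], L₀ ≤ L → Even L →
        lam * (C * ε + a) * (L : ℝ) ^ 2 ≤
          (hubbardTorus 2 L 1 U + (lam : ℂ) • (∑ m : Fin 2 → ZMod L,
              if (2 * Real.pi / (L : ℝ)) ^ 2 * (∑ i : Fin 2, (((m i).valMinAbs : ℤ) : ℝ) ^ 2) ≤ ε ^ 2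
              then ((L : ℂ) ^ 2)⁻¹ • (Matrix.conjTranspose (pairFieldAt dWaveFormFactor L m) *
                pairFieldAt dWaveFormFactor L m)
              else 0)).minEnergyOn (szSector (2 * ⌊(1 - δ) * (L : ℝ) ^ 2 / 2⌋₊) 0) -
            (hubbardTorus 2 L 1 U).minEnergyOn (szSector (2 * ⌊(1 - δ) * (L : ℝ) ^ 2 / 2⌋₊) 0) := by
  intro C hC ε₀ hε₀
  obtain ⟨ε, hε, a, ha, L₁, hFl⟩ := hF C hC ε₀ hε₀
  obtain ⟨lam, hlam, L₂, hNk⟩ := hN ε hε.1 (a / 2) (half_pos ha)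
  refine ⟨ε, hε, lam, a / 2, hlam, half_pos ha, max L₁ L₂, fun L _ hL hE => ?_⟩
  -- a normalised sector ground state of the pure torus
  obtain ⟨ψ₀, hψ₀, hgs⟩ :=
    Summit.HubbardSuperconductivity.NoGo.exists_unit_groundStateInSector_hubbardTorus L 1 U
      (Summit.HubbardSuperconductivity.NoGo.floor_pairNumber_le δ (by linarith [hδ.1]) L)
  -- abbreviations
  set H : Matrix (Finset (Orb (FermionTorus 2 L))) (Finset (Orb (FermionTorus 2 L))) ℂ :=
    hubbardTorus 2 L 1 U with hHdef
  set W : Matrix (Finset (Orb (FermionTorus 2 L))) (Finset (Orb (FermionTorus 2 L))) ℂ :=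
    (∑ m : Fin 2 → ZMod L,
      if (2 * Real.pi / (L : ℝ)) ^ 2 * (∑ i : Fin 2, (((m i).valMinAbs : ℤ) : ℝ) ^ 2) ≤ ε ^ 2
      then ((L : ℂ) ^ 2)⁻¹ • (Matrix.conjTranspose (pairFieldAt dWaveFormFactor L m) *
        pairFieldAt dWaveFormFactor L m)
      else 0) with hWdef
  set K : Submodule ℂ (Fock (Orb (FermionTorus 2 L))) :=
    szSector (2 * ⌊(1 - δ) * (L : ℝ) ^ 2 / 2⌋₊) 0 with hKdef
  -- the floor at ψ₀
  have hfloor : (C * ε + a) * (L : ℝ) ^ 2 ≤ (star ψ₀ ⬝ᵥ W *ᵥ ψ₀).re :=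
    hFl L (le_of_max_le_left hL) hE ψ₀ hψ₀ hgs
  -- left secant by the variational principle at ψ₀ for H − λ W
  have hvar := minEnergyOn_le_re_rayleigh (H + ((-lam : ℝ) : ℂ) • W) K hgs.1 hψ₀
  rw [add_mulVec, dotProduct_add, Complex.add_re, smul_mulVec, dotProduct_smul, smul_eq_mul,
    Complex.re_ofReal_mul, re_rayleigh_of_eigen_minEnergyOn H K hψ₀ hgs.2.2] at hvar
  -- no-kink at (ε, a/2)
  have hnk := hNk L (le_of_max_le_right hL) hE
  have h1 : lam * ((C * ε + a) * (L : ℝ) ^ 2) ≤ lam * (star ψ₀ ⬝ᵥ W *ᵥ ψ₀).re :=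
    mul_le_mul_of_nonneg_left hfloor hlam.le
  have key : lam * (C * ε + a / 2) * (L : ℝ) ^ 2 =
      lam * ((C * ε + a) * (L : ℝ) ^ 2) - a / 2 * lam * (L : ℝ) ^ 2 := by ring
  rw [key]
  linarith

/-- **The summit plus no-kink at its point gives the crux.** If `HubbardSuperconductivity` holds
and the no-kink bound of `windowGapAt_of_windowFloorAt_of_noKinkAt` holds at EVERY `U > 0`,
`δ ∈ (0, 1/2)` (it is needed only at the summit's witness point), then `WindowGap`: floor from the
summit (`exists_windowFloorAt_of_hubbardSuperconductivity`), gap from floor + no-kink. With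
`closes : WindowGap → WindowInfraredBound → … → HubbardSuperconductivity` this brackets the crux:
modulo {tail bound, no-kink} it IS the summit; what it adds to the summit is exactly the
uniform-in-`L` interchange of `λ → 0` with `L → ∞` (window stiffness), which the route never
consumes. Tasaki (2020) §2.1; Griffiths (1964). [folklore] -/
theorem windowGap_of_hubbardSuperconductivity_of_noKink (hS : _root_.HubbardSuperconductivity)
    (hN : ∀ U : ℝ, 0 < U → ∀ δ ∈ Set.Ioo (0 : ℝ) (1 / 2),
      ∀ ε : ℝ, 0 < ε → ∀ η : ℝ, 0 < η → ∃ lam : ℝ, 0 < lam ∧ ∃ L₀ : ℕ, ∀ (L : ℕ) [NeZero L],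
      L₀ ≤ L → Even L →
        ((hubbardTorus 2 L 1 U).minEnergyOn (szSector (2 * ⌊(1 - δ) * (L : ℝ) ^ 2 / 2⌋₊) 0) -
            (hubbardTorus 2 L 1 U + ((-lam : ℝ) : ℂ) • (∑ m : Fin 2 → ZMod L,
                if (2 * Real.pi / (L : ℝ)) ^ 2 * (∑ i : Fin 2, (((m i).valMinAbs : ℤ) : ℝ) ^ 2) ≤ ε ^ 2
                then ((L : ℂ) ^ 2)⁻¹ • (Matrix.conjTranspose (pairFieldAt dWaveFormFactor L m) *
                  pairFieldAt dWaveFormFactor L m)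
                else 0)).minEnergyOn (szSector (2 * ⌊(1 - δ) * (L : ℝ) ^ 2 / 2⌋₊) 0)) -
          ((hubbardTorus 2 L 1 U + (lam : ℂ) • (∑ m : Fin 2 → ZMod L,
                if (2 * Real.pi / (L : ℝ)) ^ 2 * (∑ i : Fin 2, (((m i).valMinAbs : ℤ) : ℝ) ^ 2) ≤ ε ^ 2
                then ((L : ℂ) ^ 2)⁻¹ • (Matrix.conjTranspose (pairFieldAt dWaveFormFactor L m) *
                  pairFieldAt dWaveFormFactor L m)
                else 0)).minEnergyOn (szSector (2 * ⌊(1 - δ) * (L : ℝ) ^ 2 / 2⌋₊) 0) -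
            (hubbardTorus 2 L 1 U).minEnergyOn (szSector (2 * ⌊(1 - δ) * (L : ℝ) ^ 2 / 2⌋₊) 0)) ≤
          η * lam * (L : ℝ) ^ 2) :
    WindowGap := by
  obtain ⟨U, hU, δ, hδ, hF⟩ := exists_windowFloorAt_of_hubbardSuperconductivity hS
  exact ⟨U, hU, δ, hδ, windowGapAt_of_windowFloorAt_of_noKinkAt hδ hF (hN U hU δ hδ)⟩

end Summit.HubbardSuperconductivity.HubbardSuperconductivity.Theorems
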